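import Literature.MathematicalPhysics.KineticTheory.SiteChainLangevinKernel
import Literature.MathematicalPhysics.KineticTheory.SiteChainFokkerPlanckProfiles
import HarnessLib

/-!
# Fokker–Planck identification for site-inhomogeneous chains, II: the energy cutoff `χ(H/R)`

Topic `Literature/MathematicalPhysics/KineticTheory`, grouping namespace `…KineticTheory.HeatConduction`.
Calculus of the energy cutoff `a_R = χ(H/R)` (`χ = smoothCutoff`: `1` on `H ≤ R`, `0` on `H ≥ 2R`)
for a site-dependent chain `P : SiteChain` (`CellChain.lean`) with `C²` potentials `U i, V i ≥ 0`,
`N ≥ 1`, `γ ≥ 0`, `T_L, T_R ≥ 0`; twin of `Summits/…/EmbeddedDrudeMourreNessUniqueCutoff.lean` and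
of the reversed-generator section of `…SubdiffusiveBondHeatKernelGibbsA.lean` for site-dependent
data:

* `SiteChain.sdeGenerator_hamiltonian_eq` — `L H = γ (T_L + T_R - A - B)`, `A = p_0²`, `B = p_{N-1}²`
  (`DH·Y = -γ(A + B)`, `D²H[v_b, v_b] = 2γT_b`), and the generators of a function of the energy:
  `L (F∘H) = γ[F'(H)(T_L + T_R - A - B) + F''(H)(T_L A + T_R B)]` (`generator_comp_hamiltonian`),
  `L̂ (F∘H) = γ[F'(H)(T_L + T_R + A + B) + F''(H)(T_L A + T_R B)]` (`revGenerator_comp_hamiltonian`,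
  `L̂ = sdeGenerator (-Y) v_L v_R` the generator of the reversed equation);
* the cutoff `a_R` (written `fun y => smoothCutoff (P.hamiltonian N y / R)`): `C²`, values in `[0,1]`,
  `= 1` on `{H ≤ R}`, `= 0` on `{2R ≤ H}`, compactly supported (`UniformlyConfining`);
* uniform bounds for `R ≥ 1`: `|L a_R| ≤ K`, `|L̂ a_R| ≤ K` with `L̂ a_R = 0` off `{R ≤ H ≤ 2R}`, and
  the bath derivatives `|D a_R · v_b| ≤ C/√R`, vanishing off the shell.

## References

* N. Cuneo, J.-P. Eckmann, M. Hairer, L. Rey-Bellet, Electron. J. Probab. **23** (2018) no. 55, §3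
  eq. (3.2)–(3.3).
-/

noncomputable section

open MeasureTheory Filter Topology Set
open scoped ContDiff NNReal ENNReal

namespace Literature.MathematicalPhysics.KineticTheory.HeatConduction

open Literature.MathematicalPhysics.KineticTheory

variable {N : ℕ}

namespace SiteChain

variable (P : SiteChain)

/-! ### The generators on functions of the energy -/

/-- `∂²_{p_i} H = 1` for the site-dependent Hamiltonian. [folklore] -/
theorem partialP_partialP_hamiltonian_U2 (N : ℕ) (x : PhaseSpace N) (i : Fin N) :
    partialP i (partialP i (P.hamiltonian N)) x = 1 := by
  have h : partialP i (P.hamiltonian N) = fun y => y.2 i := funext fun y => P.partialP_hamiltonian N y.1 y.2 i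
  rw [h]
  simp only [partialP, Function.update_self]
  exact deriv_id _

/-- `DH(x)·Y(x) = -γ (p_0² + p_{N-1}²)`: the deterministic energy balance without forcing
(`N ≥ 1`, `C¹` potentials). [cite: CuneoEckmannHairerReyBellet2018, §3 eq. (3.3)] -/
theorem fderiv_hamiltonian_langevinDrift_U2 (hU : ∀ i, ContDiff ℝ 1 (P.U i)) (hV : ∀ i, ContDiff ℝ 1 (P.V i))
    (hN : 0 < N) (x : PhaseSpace N) :
    fderiv ℝ (P.hamiltonian N) x (P.langevinDrift N x) =
      -(P.γ * (x.2 ⟨0, hN⟩ ^ 2 + x.2 ⟨N - 1, Nat.sub_lt hN one_pos⟩ ^ 2)) := by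
  have h := P.fderiv_hamiltonian_drift_eq_sum hU hV x 0
  simp only [add_zero, Prod.mk.eta, Pi.zero_apply, mul_zero, zero_sub, sub_zero] at h
  rw [h]
  simp only [OscillatorChain.bathWeight, Finset.sum_neg_distrib, mul_add, add_mul, Finset.sum_add_distrib]
  have e1 : ∑ i : Fin N, P.γ * (if i.val = 0 then (1:ℝ) else 0) * x.2 i ^ 2 =
      P.γ * ∑ i : Fin N, (if i.val = 0 then (1:ℝ) else 0) * x.2 i ^ 2 := by
    rw [Finset.mul_sum]; exact Finset.sum_congr rfl fun i _ => by ring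
  have e2 : ∑ i : Fin N, P.γ * (if i.val = N - 1 then (1:ℝ) else 0) * x.2 i ^ 2 =
      P.γ * ∑ i : Fin N, (if i.val = N - 1 then (1:ℝ) else 0) * x.2 i ^ 2 := by
    rw [Finset.mul_sum]; exact Finset.sum_congr rfl fun i _ => by ring
  rw [e1, e2, sum_ite_val_eq_mul hN 1 (fun i => x.2 i ^ 2),
    sum_ite_val_eq_mul (Nat.sub_lt hN one_pos) 1 (fun i => x.2 i ^ 2)]
  ring

/-- `DH(x)·(bathVec N k c) = c p_k` (`C¹` potentials). [folklore] -/
theorem fderiv_hamiltonian_bathVec_U2 (hU : ∀ i, ContDiff ℝ 1 (P.U i)) (hV : ∀ i, ContDiff ℝ 1 (P.V i))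
    (x : PhaseSpace N) {k : ℕ} (hk : k < N) (c : ℝ) :
    fderiv ℝ (P.hamiltonian N) x (bathVec N k c) = c * x.2 ⟨k, hk⟩ := by
  rw [P.fderiv_hamiltonian_apply hU hV]
  simp only [bathVec, Pi.zero_apply, mul_zero, zero_add]
  rw [← sum_ite_val_eq_mul hk c (fun i => x.2 i)]
  refine Finset.sum_congr rfl fun i _ => ?_
  split_ifs <;> ring

/-- `D²H(x)[bathVec N k c, bathVec N k c] = c²` (`C²` potentials; `∂²_{p_k} H = 1`). [folklore] -/
theorem fderiv_fderiv_hamiltonian_bathVec_U2 (hU : ∀ i, ContDiff ℝ 2 (P.U i)) (hV : ∀ i, ContDiff ℝ 2 (P.V i))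
    (x : PhaseSpace N) {k : ℕ} (hk : k < N) (c : ℝ) :
    fderiv ℝ (fderiv ℝ (P.hamiltonian N)) x (bathVec N k c) (bathVec N k c) = c ^ 2 := by
  have hH2 : ContDiff ℝ 2 (P.hamiltonian N) := P.contDiff_hamiltonian N hU hV
  rw [bathVec_eq_smul_unitP hk]
  simp only [map_smul, FunLike.coe_smul, Pi.smul_apply, smul_eq_mul]
  rw [← partialP_partialP_eq_fderiv_fderiv hH2, P.partialP_partialP_hamiltonian_U2]
  ring

/-- **The generator of the energy**: `L H = γ (T_L + T_R - p_0² - p_{N-1}²)` for the site-dependent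
chain (`N ≥ 1`, `γT_L, γT_R ≥ 0`, `C²` potentials; `L = sdeGenerator Y v_L v_R`).
[cite: CuneoEckmannHairerReyBellet2018, §3 eq. (3.3)] -/
theorem sdeGenerator_hamiltonian_eq (hU : ∀ i, ContDiff ℝ 2 (P.U i)) (hV : ∀ i, ContDiff ℝ 2 (P.V i))
    (hN : 0 < N) {T_L T_R : ℝ} (hL : 0 ≤ P.γ * T_L) (hR : 0 ≤ P.γ * T_R) (x : PhaseSpace N) :
    sdeGenerator (P.langevinDrift N) (P.noiseVecL N T_L) (P.noiseVecR N T_R) (P.hamiltonian N) x =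
      P.γ * (T_L + T_R - x.2 ⟨0, hN⟩ ^ 2 - x.2 ⟨N - 1, Nat.sub_lt hN one_pos⟩ ^ 2) := by
  have hU1 : ∀ i, ContDiff ℝ 1 (P.U i) := fun i => (hU i).of_le (by norm_num)
  have hV1 : ∀ i, ContDiff ℝ 1 (P.V i) := fun i => (hV i).of_le (by norm_num)
  rw [sdeGenerator_def, P.fderiv_hamiltonian_langevinDrift_U2 hU1 hV1 hN]
  unfold noiseVecL noiseVecR
  rw [P.fderiv_fderiv_hamiltonian_bathVec_U2 hU hV x hN, P.fderiv_fderiv_hamiltonian_bathVec_U2 hU hV x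
    (Nat.sub_lt hN one_pos), Real.sq_sqrt (by linarith), Real.sq_sqrt (by linarith)]
  ring

/-- **The reversed generator of a function of the energy** (site-dependent chain). For `C²`
potentials, `N ≥ 1`, `γT_L, γT_R ≥ 0` and `F` twice differentiable, with `A = p_0²`, `B = p_{N-1}²`:
`L̂ (F∘H) = γ [F'(H) (T_L + T_R + A + B) + F''(H) (T_L A + T_R B)]`, where
`L̂ = sdeGenerator (-Y) v_L v_R` (chain rule `sdeGenerator_comp`, `L̂H = LH - 2 DH·Y`,
`(DH·v_b)² = 2γT_b p_b²`). [folklore] -/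
theorem revGenerator_comp_hamiltonian (hU : ∀ i, ContDiff ℝ 2 (P.U i)) (hV : ∀ i, ContDiff ℝ 2 (P.V i))
    (hN : 0 < N) {T_L T_R : ℝ} (hL : 0 ≤ P.γ * T_L) (hR : 0 ≤ P.γ * T_R) {F F' F'' : ℝ → ℝ}
    (hF : ∀ u, HasDerivAt F (F' u) u) (hF' : ∀ u, HasDerivAt F' (F'' u) u) (x : PhaseSpace N) :
    sdeGenerator (fun y => -P.langevinDrift N y) (P.noiseVecL N T_L) (P.noiseVecR N T_R)
        (fun y => F (P.hamiltonian N y)) x =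
      P.γ * (F' (P.hamiltonian N x) *
          (T_L + T_R + x.2 ⟨0, hN⟩ ^ 2 + x.2 ⟨N - 1, Nat.sub_lt hN one_pos⟩ ^ 2) +
        F'' (P.hamiltonian N x) *
          (T_L * x.2 ⟨0, hN⟩ ^ 2 + T_R * x.2 ⟨N - 1, Nat.sub_lt hN one_pos⟩ ^ 2)) := by
  have hH2 : ContDiff ℝ 2 (P.hamiltonian N) := P.contDiff_hamiltonian N hU hV
  have hU1 : ∀ i, ContDiff ℝ 1 (P.U i) := fun i => (hU i).of_le (by norm_num)
  have hV1 : ∀ i, ContDiff ℝ 1 (P.V i) := fun i => (hV i).of_le (by norm_num)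
  rw [sdeGenerator_comp (fun y => -P.langevinDrift N y) _ _ hF hF' hH2 x]
  have hrev : sdeGenerator (fun y => -P.langevinDrift N y) (P.noiseVecL N T_L) (P.noiseVecR N T_R)
      (P.hamiltonian N) x =
      sdeGenerator (P.langevinDrift N) (P.noiseVecL N T_L) (P.noiseVecR N T_R) (P.hamiltonian N) x -
        2 * fderiv ℝ (P.hamiltonian N) x (P.langevinDrift N x) := by
    rw [sdeGenerator_def, sdeGenerator_def, map_neg]
    ring
  have hA : fderiv ℝ (P.hamiltonian N) x (P.noiseVecL N T_L) = Real.sqrt (2 * P.γ * T_L) * x.2 ⟨0, hN⟩ :=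
    P.fderiv_hamiltonian_bathVec_U2 hU1 hV1 x hN _
  have hB : fderiv ℝ (P.hamiltonian N) x (P.noiseVecR N T_R) =
      Real.sqrt (2 * P.γ * T_R) * x.2 ⟨N - 1, Nat.sub_lt hN one_pos⟩ :=
    P.fderiv_hamiltonian_bathVec_U2 hU1 hV1 x (Nat.sub_lt hN one_pos) _
  rw [hrev, P.sdeGenerator_hamiltonian_eq hU hV hN hL hR, P.fderiv_hamiltonian_langevinDrift_U2 hU1 hV1 hN,
    hA, hB, mul_pow, mul_pow, Real.sq_sqrt (by linarith), Real.sq_sqrt (by linarith)]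
  ring

/-- **The forward generator of a function of the energy** (site-dependent chain): for `C²`
potentials, `N ≥ 1`, `γT_L, γT_R ≥ 0` and `F` twice differentiable,
`L (F∘H) = γ [F'(H) (T_L + T_R - A - B) + F''(H) (T_L A + T_R B)]`, `A = p_0²`, `B = p_{N-1}²`.
[folklore] -/
theorem generator_comp_hamiltonian (hU : ∀ i, ContDiff ℝ 2 (P.U i)) (hV : ∀ i, ContDiff ℝ 2 (P.V i))
    (hN : 0 < N) {T_L T_R : ℝ} (hL : 0 ≤ P.γ * T_L) (hR : 0 ≤ P.γ * T_R) {F F' F'' : ℝ → ℝ}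
    (hF : ∀ u, HasDerivAt F (F' u) u) (hF' : ∀ u, HasDerivAt F' (F'' u) u) (x : PhaseSpace N) :
    sdeGenerator (P.langevinDrift N) (P.noiseVecL N T_L) (P.noiseVecR N T_R)
        (fun y => F (P.hamiltonian N y)) x =
      P.γ * (F' (P.hamiltonian N x) *
          (T_L + T_R - x.2 ⟨0, hN⟩ ^ 2 - x.2 ⟨N - 1, Nat.sub_lt hN one_pos⟩ ^ 2) +
        F'' (P.hamiltonian N x) *
          (T_L * x.2 ⟨0, hN⟩ ^ 2 + T_R * x.2 ⟨N - 1, Nat.sub_lt hN one_pos⟩ ^ 2)) := by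
  have hH2 : ContDiff ℝ 2 (P.hamiltonian N) := P.contDiff_hamiltonian N hU hV
  have hU1 : ∀ i, ContDiff ℝ 1 (P.U i) := fun i => (hU i).of_le (by norm_num)
  have hV1 : ∀ i, ContDiff ℝ 1 (P.V i) := fun i => (hV i).of_le (by norm_num)
  have hA : fderiv ℝ (P.hamiltonian N) x (P.noiseVecL N T_L) = Real.sqrt (2 * P.γ * T_L) * x.2 ⟨0, hN⟩ :=
    P.fderiv_hamiltonian_bathVec_U2 hU1 hV1 x hN _
  have hB : fderiv ℝ (P.hamiltonian N) x (P.noiseVecR N T_R) =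
      Real.sqrt (2 * P.γ * T_R) * x.2 ⟨N - 1, Nat.sub_lt hN one_pos⟩ :=
    P.fderiv_hamiltonian_bathVec_U2 hU1 hV1 x (Nat.sub_lt hN one_pos) _
  rw [sdeGenerator_comp (P.langevinDrift N) _ _ hF hF' hH2 x, P.sdeGenerator_hamiltonian_eq hU hV hN hL hR,
    hA, hB, mul_pow, mul_pow, Real.sq_sqrt (by linarith), Real.sq_sqrt (by linarith)]
  ring

/-! ### The energy cutoff `a_R = χ(H/R)` -/

/-- `0 ≤ a_R ≤ 1`. [folklore] -/
theorem energyCutoff_mem_Icc (R : ℝ) (x : PhaseSpace N) : smoothCutoff (P.hamiltonian N x / R) ∈ Icc (0 : ℝ) 1 :=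
  ⟨smoothCutoff_nonneg _, smoothCutoff_le_one _⟩

/-- `a_R = 1` on `{H ≤ R}` (`R > 0`). [folklore] -/
theorem energyCutoff_eq_one {R : ℝ} (hR : 0 < R) {x : PhaseSpace N} (hx : P.hamiltonian N x ≤ R) :
    smoothCutoff (P.hamiltonian N x / R) = 1 :=
  smoothCutoff_of_le_one (by rwa [div_le_one hR])

/-- `a_R = 0` on `{2R ≤ H}` (`R > 0`). [folklore] -/
theorem energyCutoff_eq_zero {R : ℝ} (hR : 0 < R) {x : PhaseSpace N} (hx : 2 * R ≤ P.hamiltonian N x) :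
    smoothCutoff (P.hamiltonian N x / R) = 0 :=
  smoothCutoff_of_two_le (by rwa [le_div_iff₀ hR])

/-- `a_R` is `C²` for `C²` potentials. [folklore] -/
theorem contDiff_energyCutoff (hU : ∀ i, ContDiff ℝ 2 (P.U i)) (hV : ∀ i, ContDiff ℝ 2 (P.V i)) (N : ℕ) (R : ℝ) :
    ContDiff ℝ 2 (fun y => smoothCutoff (P.hamiltonian N y / R)) :=
  (contDiff_smoothCutoff (n := 2)).comp ((P.contDiff_hamiltonian N hU hV).div_const R)

/-- The squared bath momenta are bounded by `4H` (`U i, V i ≥ 0`). [folklore] -/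
theorem bath_sq_le_four_mul_hamiltonian (hU0 : ∀ i q, 0 ≤ P.U i q) (hV0 : ∀ i r, 0 ≤ P.V i r) (hN : 0 < N)
    (x : PhaseSpace N) :
    x.2 ⟨0, hN⟩ ^ 2 + x.2 ⟨N - 1, Nat.sub_lt hN one_pos⟩ ^ 2 ≤ 4 * P.hamiltonian N x := by
  have hk := P.kinetic_le_hamiltonian_of_nonneg hU0 hV0 N x
  have h1 : x.2 ⟨0, hN⟩ ^ 2 / 2 ≤ ∑ i, x.2 i ^ 2 / 2 :=
    Finset.single_le_sum (f := fun i => x.2 i ^ 2 / 2) (fun i _ => by positivity) (Finset.mem_univ _)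
  have h2 : x.2 ⟨N - 1, Nat.sub_lt hN one_pos⟩ ^ 2 / 2 ≤ ∑ i, x.2 i ^ 2 / 2 :=
    Finset.single_le_sum (f := fun i => x.2 i ^ 2 / 2) (fun i _ => by positivity) (Finset.mem_univ _)
  linarith

/-- A single squared momentum is bounded by `2H` (`U i, V i ≥ 0`). [folklore] -/
theorem sq_le_two_mul_hamiltonian (hU0 : ∀ i q, 0 ≤ P.U i q) (hV0 : ∀ i r, 0 ≤ P.V i r) (x : PhaseSpace N)
    (i : Fin N) : x.2 i ^ 2 ≤ 2 * P.hamiltonian N x := by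
  have := P.site_le_hamiltonian hU0 hV0 N x i
  have := hU0 i.val (x.1 i)
  linarith

namespace UniformlyConfining

variable {P}

/-- `a_R` has compact support for uniformly confining potentials (`R > 0`). [folklore] -/
theorem hasCompactSupport_energyCutoff (hP : P.UniformlyConfining) (N : ℕ) {R : ℝ} (hR : 0 < R) :
    HasCompactSupport (fun y => smoothCutoff (P.hamiltonian N y / R)) :=
  HasCompactSupport.intro (hP.isCompact_setOf_hamiltonian_le N (2 * R)) fun x hx =>
    P.energyCutoff_eq_zero hR (le_of_lt (by simpa using hx))

/-! ### Uniform bounds on `L a_R`, `L̂ a_R` and `D a_R · v_b` -/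

section Bounds

variable (hP : P.UniformlyConfining) (hN : 0 < N) {T_L T_R : ℝ} (hTL : 0 ≤ T_L) (hTR : 0 ≤ T_R)
include hP hN hTL hTR

omit hP hN in
/-- The common estimate behind the two generator bounds: on the shell `R ≤ H ≤ 2R` (`R ≥ 1`), with
`|χ'|, |χ''| ≤ M`, `A, B ≥ 0`, `A + B ≤ 8R` and `|X| ≤ T_L + T_R + A + B`,
`|χ'(H/R)/R · X + χ''(H/R)/R/R · (T_L A + T_R B)| ≤ M (T_L + T_R + 8) + M (8 (T_L + T_R))`. [folklore] -/
theorem _root_.Literature.MathematicalPhysics.KineticTheory.HeatConduction.abs_cutoff_terms_le {M R h A B X : ℝ}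
    (hM : ∀ u, |deriv smoothCutoff u| ≤ M ∧ |deriv (deriv smoothCutoff) u| ≤ M) (hR : 1 ≤ R) (hA0 : 0 ≤ A)
    (hB0 : 0 ≤ B) (hAB8 : A + B ≤ 8 * R) (hX : |X| ≤ T_L + T_R + A + B) :
    |deriv smoothCutoff (h / R) / R * X + deriv (deriv smoothCutoff) (h / R) / R / R * (T_L * A + T_R * B)| ≤
      M * (T_L + T_R + 8) + M * (8 * (T_L + T_R)) := by
  have hR0 : 0 < R := by linarith
  have hM0 : 0 ≤ M := (abs_nonneg _).trans (hM 0).1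
  obtain ⟨hχ₁, hχ₂⟩ := hM (h / R)
  have t1 : |deriv smoothCutoff (h / R) / R * X| ≤ M * (T_L + T_R + 8) := by
    rw [abs_mul, abs_div, abs_of_pos hR0]
    have h2 : |X| ≤ (T_L + T_R + 8) * R := by nlinarith
    calc |deriv smoothCutoff (h / R)| / R * |X|
        ≤ |deriv smoothCutoff (h / R)| / R * ((T_L + T_R + 8) * R) :=
          mul_le_mul_of_nonneg_left h2 (by positivity)
      _ = |deriv smoothCutoff (h / R)| * (T_L + T_R + 8) := by field_simp
      _ ≤ M * (T_L + T_R + 8) := mul_le_mul_of_nonneg_right hχ₁ (by positivity)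
  have t2 : |deriv (deriv smoothCutoff) (h / R) / R / R * (T_L * A + T_R * B)| ≤ M * (8 * (T_L + T_R)) := by
    rw [abs_mul, abs_div, abs_div, abs_of_pos hR0, abs_of_nonneg (by positivity : 0 ≤ T_L * A + T_R * B)]
    have h3 : T_L * A + T_R * B ≤ (T_L + T_R) * (8 * R) := by nlinarith
    have h4 : (T_L + T_R) * (8 * R) ≤ (8 * (T_L + T_R)) * (R * R) := by
      have hRR : R ≤ R * R := by nlinarith
      calc (T_L + T_R) * (8 * R) = (8 * (T_L + T_R)) * R := by ring
        _ ≤ (8 * (T_L + T_R)) * (R * R) := mul_le_mul_of_nonneg_left hRR (by positivity)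
    calc |deriv (deriv smoothCutoff) (h / R)| / R / R * (T_L * A + T_R * B)
        ≤ |deriv (deriv smoothCutoff) (h / R)| / R / R * ((8 * (T_L + T_R)) * (R * R)) :=
          mul_le_mul_of_nonneg_left (h3.trans h4) (by positivity)
      _ = |deriv (deriv smoothCutoff) (h / R)| * (8 * (T_L + T_R)) := by field_simp
      _ ≤ M * (8 * (T_L + T_R)) := mul_le_mul_of_nonneg_right hχ₂ (by positivity)
  exact (abs_add_le _ _).trans (add_le_add t1 t2)

/-- **Uniform bound on the forward generator of the energy cutoff** (site-dependent chain): there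
is `K` with `|L a_R| ≤ K` on phase space for all `R ≥ 1`. [folklore] -/
theorem abs_generator_energyCutoff_le :
    ∃ K : ℝ, 0 ≤ K ∧ ∀ R : ℝ, 1 ≤ R → ∀ x : PhaseSpace N,
      |sdeGenerator (P.langevinDrift N) (P.noiseVecL N T_L) (P.noiseVecR N T_R)
        (fun y => smoothCutoff (P.hamiltonian N y / R)) x| ≤ K := by
  obtain ⟨M, hM0, hM₁, hM₂⟩ := exists_bound_derivs_smoothCutoff
  have hγ := hP.γ_nonneg
  refine ⟨P.γ * (M * (T_L + T_R + 8) + M * (8 * (T_L + T_R))), by positivity, fun R hR x => ?_⟩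
  have hR0 : 0 < R := by linarith
  have h := P.generator_comp_hamiltonian hP.contDiff_U hP.contDiff_V hN (mul_nonneg hγ hTL) (mul_nonneg hγ hTR)
    (hasDerivAt_scaled_smoothCutoff R) (hasDerivAt_deriv_scaled_smoothCutoff R) x
  rw [h, abs_mul, abs_of_nonneg hγ]
  refine mul_le_mul_of_nonneg_left ?_ hγ
  set Hx := P.hamiltonian N x
  set A := x.2 ⟨0, hN⟩ ^ 2
  set B := x.2 ⟨N - 1, Nat.sub_lt hN one_pos⟩ ^ 2
  have hA0 : 0 ≤ A := sq_nonneg _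
  have hB0 : 0 ≤ B := sq_nonneg _
  have hAB : A + B ≤ 4 * Hx := P.bath_sq_le_four_mul_hamiltonian hP.U_nonneg hP.V_nonneg hN x
  by_cases hshell : R ≤ Hx ∧ Hx ≤ 2 * R
  · refine abs_cutoff_terms_le hTL hTR (fun u => ⟨hM₁ u, hM₂ u⟩) hR hA0 hB0 (by linarith) ?_
    rw [abs_le]; constructor <;> linarith
  · rw [deriv_smoothCutoff_div_eq_zero_of_not_shell hR0 hshell,
      deriv_deriv_smoothCutoff_div_eq_zero_of_not_shell hR0 hshell]
    simp only [zero_div, zero_mul, add_zero, abs_zero]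
    positivity

/-- **Uniform bound on the reversed generator of the energy cutoff, supported on the shell**
(site-dependent chain): there is `K` with `|L̂ a_R| ≤ K` everywhere and `L̂ a_R(x) = 0` unless
`R ≤ H(x) ≤ 2R`, for all `R ≥ 1`. [folklore] -/
theorem abs_revGenerator_energyCutoff_le :
    ∃ K : ℝ, 0 ≤ K ∧ ∀ R : ℝ, 1 ≤ R → ∀ x : PhaseSpace N,
      |sdeGenerator (fun y => -P.langevinDrift N y) (P.noiseVecL N T_L) (P.noiseVecR N T_R)
          (fun y => smoothCutoff (P.hamiltonian N y / R)) x| ≤ K ∧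
      (¬ (R ≤ P.hamiltonian N x ∧ P.hamiltonian N x ≤ 2 * R) →
        sdeGenerator (fun y => -P.langevinDrift N y) (P.noiseVecL N T_L) (P.noiseVecR N T_R)
          (fun y => smoothCutoff (P.hamiltonian N y / R)) x = 0) := by
  obtain ⟨M, hM0, hM₁, hM₂⟩ := exists_bound_derivs_smoothCutoff
  have hγ := hP.γ_nonneg
  refine ⟨P.γ * (M * (T_L + T_R + 8) + M * (8 * (T_L + T_R))), by positivity, fun R hR x => ?_⟩
  have hR0 : 0 < R := by linarith
  have h := P.revGenerator_comp_hamiltonian hP.contDiff_U hP.contDiff_V hN (mul_nonneg hγ hTL) (mul_nonneg hγ hTR)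
    (hasDerivAt_scaled_smoothCutoff R) (hasDerivAt_deriv_scaled_smoothCutoff R) x
  rw [h]
  set Hx := P.hamiltonian N x
  set A := x.2 ⟨0, hN⟩ ^ 2
  set B := x.2 ⟨N - 1, Nat.sub_lt hN one_pos⟩ ^ 2
  have hA0 : 0 ≤ A := sq_nonneg _
  have hB0 : 0 ≤ B := sq_nonneg _
  have hAB : A + B ≤ 4 * Hx := P.bath_sq_le_four_mul_hamiltonian hP.U_nonneg hP.V_nonneg hN x
  by_cases hshell : R ≤ Hx ∧ Hx ≤ 2 * R
  · refine ⟨?_, fun hc => absurd hshell hc⟩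
    rw [abs_mul, abs_of_nonneg hγ]
    refine mul_le_mul_of_nonneg_left ?_ hγ
    refine abs_cutoff_terms_le hTL hTR (fun u => ⟨hM₁ u, hM₂ u⟩) hR hA0 hB0 (by linarith) ?_
    rw [abs_of_nonneg (by positivity)]
  · rw [deriv_smoothCutoff_div_eq_zero_of_not_shell hR0 hshell,
      deriv_deriv_smoothCutoff_div_eq_zero_of_not_shell hR0 hshell]
    refine ⟨?_, fun _ => by simp⟩
    simp only [zero_div, zero_mul, add_zero, mul_zero, abs_zero]
    positivity

omit hN hTL hTR in
/-- **The bath derivatives of the energy cutoff are `O(R^{-1/2})` and live on the shell**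
(site-dependent chain): `D a_R(x)·(bathVec N k c) = χ'(H/R) c p_k / R`, so
`|D a_R(x)·(bathVec N k c)| ≤ 2 M |c| / √R` for `R ≥ 1` (`p_k² ≤ 2H ≤ 4R` on the shell) and it
vanishes unless `R ≤ H(x) ≤ 2R`. [folklore] -/
theorem abs_fderiv_energyCutoff_bathVec_le :
    ∃ C : ℝ, 0 ≤ C ∧ ∀ R : ℝ, 1 ≤ R → ∀ (x : PhaseSpace N) {k : ℕ} (hk : k < N) (c : ℝ),
      |fderiv ℝ (fun y => smoothCutoff (P.hamiltonian N y / R)) x (bathVec N k c)| ≤ C * |c| / Real.sqrt R ∧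
      (¬ (R ≤ P.hamiltonian N x ∧ P.hamiltonian N x ≤ 2 * R) →
        fderiv ℝ (fun y => smoothCutoff (P.hamiltonian N y / R)) x (bathVec N k c) = 0) := by
  obtain ⟨M, hM0, hM₁, -⟩ := exists_bound_derivs_smoothCutoff
  refine ⟨2 * M, by positivity, fun R hR x k hk c => ?_⟩
  have hR0 : 0 < R := by linarith
  have hU1 : ∀ i, ContDiff ℝ 1 (P.U i) := fun i => (hP.contDiff_U i).of_le (by norm_num)
  have hV1 : ∀ i, ContDiff ℝ 1 (P.V i) := fun i => (hP.contDiff_V i).of_le (by norm_num)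
  have hHd : Differentiable ℝ (P.hamiltonian N) := hP.differentiable_hamiltonian N
  have hD : fderiv ℝ (fun y => smoothCutoff (P.hamiltonian N y / R)) x (bathVec N k c) =
      deriv smoothCutoff (P.hamiltonian N x / R) / R * (c * x.2 ⟨k, hk⟩) := by
    rw [fderiv_comp_eq_smul (hasDerivAt_scaled_smoothCutoff R) hHd]
    simp only [FunLike.coe_smul, Pi.smul_apply, smul_eq_mul]
    rw [P.fderiv_hamiltonian_bathVec_U2 hU1 hV1 x hk c]
  rw [hD]
  set Hx := P.hamiltonian N x
  by_cases hshell : R ≤ Hx ∧ Hx ≤ 2 * R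
  · refine ⟨?_, fun hc => absurd hshell hc⟩
    have hp2 : x.2 ⟨k, hk⟩ ^ 2 ≤ 4 * R := by
      have := P.sq_le_two_mul_hamiltonian hP.U_nonneg hP.V_nonneg x ⟨k, hk⟩
      linarith [hshell.2]
    have hp : |x.2 ⟨k, hk⟩| ≤ 2 * Real.sqrt R := by
      have h4 : (4 : ℝ) * R = (2 * Real.sqrt R) ^ 2 := by
        rw [mul_pow, Real.sq_sqrt hR0.le]; norm_num
      rw [h4] at hp2
      exact abs_le.2 (abs_le_of_sq_le_sq' hp2 (by positivity))
    have hsR : 0 < Real.sqrt R := Real.sqrt_pos.2 hR0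
    have hRs : R = Real.sqrt R * Real.sqrt R := (Real.mul_self_sqrt hR0.le).symm
    rw [abs_mul, abs_mul, abs_div, abs_of_pos hR0, le_div_iff₀ hsR]
    calc |deriv smoothCutoff (Hx / R)| / R * (|c| * |x.2 ⟨k, hk⟩|) * Real.sqrt R
        ≤ M / R * (|c| * (2 * Real.sqrt R)) * Real.sqrt R := by
          apply mul_le_mul_of_nonneg_right _ hsR.le
          exact mul_le_mul (div_le_div_of_nonneg_right (hM₁ _) hR0.le)
            (mul_le_mul_of_nonneg_left hp (abs_nonneg c)) (by positivity) (by positivity)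
      _ = 2 * M * |c| * (Real.sqrt R * Real.sqrt R / R) := by ring
      _ = 2 * M * |c| := by rw [← hRs, div_self hR0.ne', mul_one]
  · rw [deriv_smoothCutoff_div_eq_zero_of_not_shell hR0 hshell]
    refine ⟨?_, fun _ => by simp⟩
    simp only [zero_div, zero_mul, abs_zero]
    positivity

end Bounds

end UniformlyConfining

end SiteChain

end Literature.MathematicalPhysics.KineticTheory.HeatConduction
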